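import Summits.HodgeConjecture.HodgeConjecture.Theorems.VHCAbelianSchemesRoadMoverTrapDefs
import Summits.HodgeConjecture.HodgeConjecture.Theorems.VHCAbelianSchemesRoadNowhereDisplaceableDefs
import HarnessLib

/-!
# FactorJumpIsogeny — typed cut of the crux idea «factor-jump-isogeny» (lens «transfer», seat plan-lens-HodgeAV-26512-transfer g3), crux stmt-HodgeConjecture-26512,
# research stub (S4) `stub_properJumpCarrierExists_End` of `Lines/birth.lean` v3.18 (= `Lines/MoverTrap.lean` rev2 l.288).
research route conditional on HC_CM; not a corollary; Q11.4-sentence-2 already refuted in dim ≥ 3.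
NOTHING here says (S4), (N-U), (c4a), the crux, №4, HC_AV, HC_CM or HC holds; typed ≠ proved; a displayed input is not progress.
This file only shows that the card's `First lemma:` and its typed cut of (N-U) ELABORATE over existing declarations, and that the cut composes
(sorry-free) to the matrix of (N-U) = `ProperJump (J × Ĵ) (q^*𝓓.E)` — and (rev 2, rebased on the landed defs brick `…NowhereDisplaceableDefs` ac09fbcdb476) to (N-U)'s statement BY NAME (`upstairsProperJumpCarrierExists_End_of_factorConfined`). The mathematics (Λ₂ is an isogeny; single-twist orthogonality; the mixed
jump divisor) is in `Cruxes/DiagLocalOfMarkmanPinnedForall/PENCIL-26512-T13.md`.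
-/

noncomputable section

set_option linter.dupNamespace false -- the Cruxes namespace repeats the summit name, as in every file of this directory

open CategoryTheory CategoryTheory.Limits AlgebraicGeometry Topology

namespace Summit.HodgeConjecture.HodgeConjecture.Cruxes.DiagLocalOfMarkmanPinnedForall.FactorJumpIsogeny

open Literature.AlgebraicGeometry Literature.AlgebraicGeometry.Motives Literature.AlgebraicGeometry.Motives.AbelianVariety
open Literature.AlgebraicGeometry.HodgeTheory Literature.AlgebraicGeometry.Markman2025
open Literature.AlgebraicTopology.SingularHomology
open Summit.HodgeConjecture.HodgeConjecture.Ring2.SemiregularRepresentatives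
open Summit.HodgeConjecture.HodgeConjecture.Ring2.SemiregularRepresentatives.MoverTrap
open Summit.HodgeConjecture.HodgeConjecture.Ring2.SemiregularRepresentatives.NowhereDisplaceable

/-- **(U-pre) — the card's FIRST LEMMA (scheme API, TRUE, size M)**: the preimage under an isogeny `Λ : J × Ĵ → J × Ĵ` of (the `ℂ`-points of)
a PROPER closed subscheme `W ↪ J × Ĵ` lies in (the `ℂ`-points of) a PROPER closed subscheme `V ↪ J × Ĵ` — take `V := Λ⁻¹(W) = W ×_{J×Ĵ} (J × Ĵ)`
(base change of a closed immersion), and `V(ℂ) ≠ (J × Ĵ)(ℂ)` because `Λ` is surjective on `ℂ`-points (tree: `pointsMap_surjective`) so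
`Λ(V(ℂ)) ⊆ W(ℂ) ≠ univ`. [cite: MumfordAV1970, §7 Thm. 4 (p. 72)] [cite: GortzWedhorn2020, Prop. 4.20 and §4.11 (base change of immersions)] -/
theorem stub_preimage_properClosed_of_isIsogeny :
    ∀ (D : SecantQuotientDatum) (Λ : D.P ⟶ D.P), IsIsogeny Λ →
      ∀ (W : SchemeOver ℂ) (κ : W ⟶ D.P.X), IsClosedImmersion κ.left →
        Set.range (AlgPoints.map (L := ℂ) κ) ≠ Set.univ →
        ∃ (V : SchemeOver ℂ) (ι : V ⟶ D.P.X), IsClosedImmersion ι.left ∧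
          Set.range (AlgPoints.map (L := ℂ) ι) ≠ Set.univ ∧
          ∀ p : D.P.Points ℂ, AlgPoints.map Λ.hom.hom.hom p ∈ Set.range (AlgPoints.map (L := ℂ) κ) →
            p ∈ Set.range (AlgPoints.map (L := ℂ) ι) := by
  sorry

/-- **(U-fac) — FACTOR-CONFINED UPSTAIRS CARRIER at every End-trivial non-hyperelliptic H-good datum** (the transfer reading of (N-U)):
some `AdmTw′`-pinned served `𝓓` on `Y`, an ISOGENY `Λ` of `J × Ĵ` and a PROPER closed `W ↪ J × Ĵ` with `Λ(J(q^*𝓓.E)) ⊆ W(ℂ)`.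
On paper for print's `Ē_a`: `Λ = Λ₂` (the factor-2 parameter map, an isogeny by PENCIL-26512-T13 §2) and `W` = the closure of the threefold
twisted-jump set `J₂(I_𝒵)`, proper by T13 §3 (Farkas–Mustaţă–Popa: `Θ_{N_C} = C − C`). Logically (U-fac) ⟸ (N-U) with `Λ := 𝟙` — the typed
cut carries no extra strength; its content is the NAMED witness pair `(Λ₂, J₂)`. IN-HOUSE; research; a `def`, nothing asserted.
[cite: Markman2025SecantWeil, §9.3 Lemma 9.3.3, 9.3.5, 9.3.6 and Remark 9.3.7] [cite: Orlov2002DerivedAbelian, Thm. 2.10 and Cor. 2.13] -/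
@[conjecture] def FactorConfinedCarrierEnd (C : ChernCharacterBetti) : Prop :=
  ∀ (D : SecantQuotientDatum) (θ₀ : complexBetti D.𝒥.J.X 2),
    ¬ D.𝒥.IsHyperelliptic → OrbitTranslatesDisjoint D.𝒥 D.G₁ D.G₂ → D.𝒥.J.IsPolarizationClassOf D.Θ θ₀ → EndTrivial D →
    ∃ γ ∈ secantQuotientServedClassesPinned D.Y.X (D.hY θ₀), ∃ 𝓓 : PinnedTwistedDatum C AdmTw' D.Y.X (D.hY θ₀) γ,
      ∃ (Λ : D.P ⟶ D.P), IsIsogeny Λ ∧ ∃ (W : SchemeOver ℂ) (κ : W ⟶ D.P.X), IsClosedImmersion κ.left ∧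
        Set.range (AlgPoints.map (L := ℂ) κ) ≠ Set.univ ∧
        ∀ p ∈ extJumpLocus D.P (quotientPullbackComplex D 𝓓.E), AlgPoints.map Λ.hom.hom.hom p ∈ Set.range (AlgPoints.map (L := ℂ) κ)

/-- **COMPOSITION (sorry-free logic)**: (U-pre) and (U-fac) give the matrix of (N-U) — an upstairs PROPER-JUMP carrier
(`ProperJump (J × Ĵ) (q^*𝓓.E)` of `Lines/NowhereDisplaceable.lean`, inlined) at every End-trivial non-hyperelliptic H-good datum.
[cite: MumfordAV1970, §7 Thm. 4 (p. 72)] -/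
theorem upstairsProperJumpCarrier_End_of_factorConfined (C : ChernCharacterBetti)
    (hpre : ∀ (D : SecantQuotientDatum) (Λ : D.P ⟶ D.P), IsIsogeny Λ →
      ∀ (W : SchemeOver ℂ) (κ : W ⟶ D.P.X), IsClosedImmersion κ.left →
        Set.range (AlgPoints.map (L := ℂ) κ) ≠ Set.univ →
        ∃ (V : SchemeOver ℂ) (ι : V ⟶ D.P.X), IsClosedImmersion ι.left ∧
          Set.range (AlgPoints.map (L := ℂ) ι) ≠ Set.univ ∧
          ∀ p : D.P.Points ℂ, AlgPoints.map Λ.hom.hom.hom p ∈ Set.range (AlgPoints.map (L := ℂ) κ) →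
            p ∈ Set.range (AlgPoints.map (L := ℂ) ι))
    (hfac : FactorConfinedCarrierEnd C) :
    ∀ (D : SecantQuotientDatum) (θ₀ : complexBetti D.𝒥.J.X 2),
      ¬ D.𝒥.IsHyperelliptic → OrbitTranslatesDisjoint D.𝒥 D.G₁ D.G₂ → D.𝒥.J.IsPolarizationClassOf D.Θ θ₀ → EndTrivial D →
      ∃ γ ∈ secantQuotientServedClassesPinned D.Y.X (D.hY θ₀), ∃ 𝓓 : PinnedTwistedDatum C AdmTw' D.Y.X (D.hY θ₀) γ,
        ∃ (V : SchemeOver ℂ) (ι : V ⟶ D.P.X), IsClosedImmersion ι.left ∧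
          Set.range (AlgPoints.map (L := ℂ) ι) ≠ Set.univ ∧
          extJumpLocus D.P (quotientPullbackComplex D 𝓓.E) ⊆ {1} ∪ Set.range (AlgPoints.map (L := ℂ) ι) := by
  intro D θ₀ hnh hH hθ₀ hEnd
  obtain ⟨γ, hγ, 𝓓, Λ, hΛ, W, κ, hκ, hW, hconf⟩ := hfac D θ₀ hnh hH hθ₀ hEnd
  obtain ⟨V, ι, hι, hV, hpre'⟩ := hpre D Λ hΛ W κ hκ hW
  exact ⟨γ, hγ, 𝓓, V, ι, hι, hV, fun p hp => Or.inr (hpre' p (hconf p hp))⟩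


/-- **COMPOSITION, BY NAME (rev 2, rebased on the landed defs brick `…NowhereDisplaceableDefs` ac09fbcdb476)**: (U-pre) and (U-fac) (for every `C`)
give the statement of (N-U) `stub_upstairsProperJumpCarrierExists_End` of `Lines/NowhereDisplaceable.lean` VERBATIM —
`ProperJump D.P (quotientPullbackComplex D 𝓓.E)` over the brick's constants — so a later bind is one token. Sorry-free logic; proves no stub.
[cite: MumfordAV1970, §7 Thm. 4 (p. 72)] -/
theorem upstairsProperJumpCarrierExists_End_of_factorConfined
    (hpre : ∀ (D : SecantQuotientDatum) (Λ : D.P ⟶ D.P), IsIsogeny Λ →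
      ∀ (W : SchemeOver ℂ) (κ : W ⟶ D.P.X), IsClosedImmersion κ.left →
        Set.range (AlgPoints.map (L := ℂ) κ) ≠ Set.univ →
        ∃ (V : SchemeOver ℂ) (ι : V ⟶ D.P.X), IsClosedImmersion ι.left ∧
          Set.range (AlgPoints.map (L := ℂ) ι) ≠ Set.univ ∧
          ∀ p : D.P.Points ℂ, AlgPoints.map Λ.hom.hom.hom p ∈ Set.range (AlgPoints.map (L := ℂ) κ) →
            p ∈ Set.range (AlgPoints.map (L := ℂ) ι))
    (hfac : ∀ C : ChernCharacterBetti, FactorConfinedCarrierEnd C) :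
    ∀ (C : ChernCharacterBetti) (D : SecantQuotientDatum) (θ₀ : complexBetti D.𝒥.J.X 2),
      ¬ D.𝒥.IsHyperelliptic → OrbitTranslatesDisjoint D.𝒥 D.G₁ D.G₂ → D.𝒥.J.IsPolarizationClassOf D.Θ θ₀ → EndTrivial D →
      ∃ γ ∈ secantQuotientServedClassesPinned D.Y.X (D.hY θ₀), ∃ 𝓓 : PinnedTwistedDatum C AdmTw' D.Y.X (D.hY θ₀) γ,
        ProperJump D.P (quotientPullbackComplex D 𝓓.E) := by
  intro C D θ₀ hnh hH hθ₀ hEnd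
  obtain ⟨γ, hγ, 𝓓, V, ι, hι, hV, hsub⟩ :=
    upstairsProperJumpCarrier_End_of_factorConfined C hpre (hfac C) D θ₀ hnh hH hθ₀ hEnd
  exact ⟨γ, hγ, 𝓓, V, ι, hι, hV, hsub⟩

end Summit.HodgeConjecture.HodgeConjecture.Cruxes.DiagLocalOfMarkmanPinnedForall.FactorJumpIsogeny
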